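import Mathlib
import Literature.Probability.Percolation.DiagonalStripRecursionScalar
import HarnessLib

/-!
# Inversion covariance of the sum `Z` and the direct wheel roots `z_1 = q z_j`

Topic `Literature/Probability/Percolation`. Consequences of the qKZ system for the sum
`Z = Σ_Q P_Q` of the loop-weight-one ground state (Ikhlef–Ponsaing, J. Stat. Phys. 149 (2012),
arXiv:1202.5476, §3.4 (21)–(22), §3.6): `Z` is covariant under EVERY inversion `z_j ↦ 1/z_j`,
`1 ≤ j ≤ L`, with one and the same monomial factor (conjugating `ι_1` by the transposition `(1 j)`,
under which `Z` is invariant), and the numerator `η_1(Z)` of the recursion scalar of (25) vanishes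
under `z_1 = q z_j`, `3 ≤ j ≤ L` (the direct wheel roots, transported from `X_j ↦ q² X_1` by
`q³ = 1`).

* `genRename_genZ`, `genRename_genC`, `genInv_conj_swap` — `(a b) ∘ ι_a ∘ (a b) = ι_b` on the rapidity field;
* `sum_genInv_covariant` — `ι_j Z = z_j^{2a'} Z` for all `1 ≤ j ≤ L` from `ι_1 ψ = z_1^{2a'} ψ` and the
  full symmetry of `Z`;
* `substHom_one_comp_substHom_wheel` — `[X_1 ↦ q X_j] ∘ [X_j ↦ q² X_1] = [X_1 ↦ q X_j]`;
* `substHom_wheel_hypSubst_sum_eq_zero`, `substHom_one_hypSubst_sum_eq_zero` — `E_j η_1(Z) = 0` and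
  `η_1(Z)|_{X_1 = q X_j} = 0` for `3 ≤ j ≤ L`.

## References

* Y. Ikhlef, A. K. Ponsaing, *Finite-size left-passage probability in percolation*, J. Stat. Phys.
  149 (2012) 10–36, arXiv:1202.5476, §3.4 (21)–(22), (25), §3.6. [IkhlefPonsaing2012]
-/

namespace Literature.Probability.Percolation

open Finset Literature.Probability.LatticeModels Literature.Probability.LatticeModels.TemperleyLieb

/-! ### Conjugating inversions by transpositions -/

section InvConj

open MvPolynomial

/-- `genRename` on the rapidities. [folklore] -/
theorem genRename_genZ (e : Equiv.Perm ℕ) (n : ℕ) : genRename e (genZ ℂ n) = genZ ℂ (e n) := by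
  rw [show genZ ℂ n = toRF ℂ (X n) from rfl, genRename_toRF, rename_X]; rfl

/-- `genRename` on constants. [folklore] -/
theorem genRename_genC (e : Equiv.Perm ℕ) (a : ℂ) : genRename e (genC ℂ a) = genC ℂ a := by
  rw [show genC ℂ a = toRF ℂ (C a) from rfl, genRename_toRF, rename_C]

/-- **`(a b) ∘ ι_a ∘ (a b) = ι_b`.** [folklore] -/
theorem genInv_conj_swap (a b : ℕ) (x : RapidityField ℂ) :
    genRename (Equiv.swap a b) (genInv ℂ a (genRename (Equiv.swap a b) x)) = genInv ℂ b x := by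
  have key : ((genRename (Equiv.swap a b)).toRingHom.comp ((genInv ℂ a).comp
      (genRename (Equiv.swap a b)).toRingHom)) = genInv ℂ b := by
    refine rapidityField_ringHom_ext (fun c => ?_) (fun n => ?_)
    · simp only [RingHom.comp_apply, RingEquiv.toRingHom_eq_coe, RingHom.coe_coe, genRename_genC, genInv_genC]
    · simp only [RingHom.comp_apply, RingEquiv.toRingHom_eq_coe, RingHom.coe_coe, genRename_genZ, genInv_genZ,
        Function.update_apply]
      by_cases hn : n = b
      · subst hn
        rw [Equiv.swap_apply_right, if_pos rfl, map_inv₀, genRename_genZ, Equiv.swap_apply_left, if_pos rfl]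
      · by_cases hna : n = a
        · subst hna
          rw [Equiv.swap_apply_left, if_neg (Ne.symm hn), genRename_genZ, Equiv.swap_apply_right, if_neg hn]
        · rw [Equiv.swap_apply_of_ne_of_ne hna hn, if_neg hna, genRename_genZ,
            Equiv.swap_apply_of_ne_of_ne hna hn, if_neg hn]
  exact RingHom.congr_fun key x

end InvConj

/-! ### `ι_j Z = z_j^{2a'} Z` for every `j` -/

section SumInversion

open MvPolynomial

variable {m : ℕ}

/-- **Inversion covariance of the sum in every rapidity.** If `ι_1 ψ_Q = z_1^{2a'} ψ_Q` for all `Q`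
and the polynomial sum `Σ_Q P_Q` is invariant under the transpositions `(1 j)`, `j ≤ L`, then
`ι_j Z = z_j^{2a'} Z` for all `1 ≤ j ≤ L`. [cite: IkhlefPonsaing2012, §3.4 (21)–(22), §3.6] -/
theorem sum_genInv_covariant {P : ColPattern m → MvPolynomial ℕ ℂ} {a' : ℤ}
    (hbot : ∀ Q, genInv ℂ 1 (toRF ℂ (P Q)) = genZ ℂ 1 ^ (2 * a') * toRF ℂ (P Q))
    (hsym : ∀ a b : ℕ, 1 ≤ a → a ≤ b → b ≤ 2 * m + 1 → rename (Equiv.swap a b) (∑ Q, P Q) = ∑ Q, P Q)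
    {j : ℕ} (hj1 : 1 ≤ j) (hjL : j ≤ 2 * m + 1) :
    genInv ℂ j (toRF ℂ (∑ Q, P Q)) = genZ ℂ j ^ (2 * a') * toRF ℂ (∑ Q, P Q) := by
  have h1 : genInv ℂ 1 (toRF ℂ (∑ Q, P Q)) = genZ ℂ 1 ^ (2 * a') * toRF ℂ (∑ Q, P Q) := by
    rw [map_sum, map_sum, Finset.mul_sum]
    exact Finset.sum_congr rfl fun Q _ => hbot Q
  have hswap : genRename (Equiv.swap 1 j) (toRF ℂ (∑ Q, P Q)) = toRF ℂ (∑ Q, P Q) := by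
    rw [genRename_toRF, hsym 1 j le_rfl hj1 hjL]
  rw [← genInv_conj_swap 1 j, hswap, h1, map_mul, map_zpow₀, genRename_genZ, Equiv.swap_apply_left, hswap]

end SumInversion

/-! ### The direct wheel roots `z_1 = q z_j` of `η_1(Z)` -/

section DirectRoots

open MvPolynomial

variable {n : ℕ}

/-- `[X_1 ↦ q X_j] ∘ [X_j ↦ q² X_1] = [X_1 ↦ q X_j]` (`q³ = 1`, `j ≠ 1`). [folklore] -/
theorem substHom_one_comp_substHom_wheel {q : ℂ} (hq : q ^ 2 + q + 1 = 0) {j : ℕ} (hj : j ≠ 1) :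
    (substHom 1 (C q * X j)).comp (substHom j (C (q ^ 2) * X 1)) = substHom (K₀ := ℂ) 1 (C q * X j) := by
  have hq3 : q ^ 3 = 1 := by linear_combination (q - 1) * hq
  refine MvPolynomial.algHom_ext fun k => ?_
  rw [AlgHom.comp_apply]
  by_cases hkj : k = j
  · subst hkj
    rw [substHom_X_self, map_mul, substHom_C, substHom_X_self, substHom_X_of_ne _ hj, ← mul_assoc, ← map_mul,
      show q ^ 2 * q = 1 by rw [← hq3]; ring, C_1, one_mul]
  · rw [substHom_X_of_ne _ hkj]

/-- **`E_j η_1(Z) = 0`** for the sum (`E_j : X_j ↦ q² X_1`, `3 ≤ j`, `Σ P` invariant under `(3 j)`).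
[cite: IkhlefPonsaing2012, §3.4–3.6] -/
theorem substHom_wheel_hypSubst_sum_eq_zero {q : ℂ} (hq : q ^ 2 + q + 1 = 0)
    {P : ColPattern (n + 1) → MvPolynomial ℕ ℂ}
    (hP : ∀ Q', ∑ Q, ipTransferMatrixW (n + 1) (genC ℂ q) (genW ℂ) (genZ ℂ) Q Q' * toRF ℂ (P Q) = toRF ℂ (P Q'))
    {j : ℕ} (hj : 3 ≤ j) (hsym : rename (Equiv.swap 3 j) (∑ Q, P Q) = ∑ Q, P Q) :
    substHom j (C (q ^ 2) * X 1) (hypSubst q 1 (∑ Q, P Q)) = 0 := by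
  have h := groundState_sum_wheel hq hP hj hsym
  have e := RingHom.congr_fun (aeval_wheel_eq_substHom_comp_hypSubst q hj) (∑ Q, P Q)
  simp only [AlgHom.toRingHom_eq_coe, RingHom.coe_coe, RingHom.comp_apply] at e
  rw [← e]; exact h

/-- **`η_1(Z)|_{X_1 = q X_j} = 0`, `3 ≤ j ≤ L`** (the direct wheel roots of the recursion scalar in the
variable `z_1`). [cite: IkhlefPonsaing2012, (25)–(27)] -/
theorem substHom_one_hypSubst_sum_eq_zero {q : ℂ} (hq : q ^ 2 + q + 1 = 0)
    {P : ColPattern (n + 1) → MvPolynomial ℕ ℂ}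
    (hP : ∀ Q', ∑ Q, ipTransferMatrixW (n + 1) (genC ℂ q) (genW ℂ) (genZ ℂ) Q Q' * toRF ℂ (P Q) = toRF ℂ (P Q'))
    {j : ℕ} (hj : 3 ≤ j) (hsym : rename (Equiv.swap 3 j) (∑ Q, P Q) = ∑ Q, P Q) :
    substHom 1 (C q * X j) (hypSubst q 1 (∑ Q, P Q)) = 0 := by
  have h := substHom_wheel_hypSubst_sum_eq_zero hq hP hj hsym
  have := congrArg (substHom 1 (C q * X j)) h
  rwa [map_zero, ← AlgHom.comp_apply, substHom_one_comp_substHom_wheel hq (show j ≠ 1 by omega)] at this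

/-- The same for every component numerator `η_1(P_k)` (from `DiagonalStripRecursionScalar`).
[cite: IkhlefPonsaing2012, (25)–(27)] -/
theorem substHom_one_hypSubst_eq_zero {q : ℂ} (hq : q ^ 2 + q + 1 = 0)
    {P : ColPattern (n + 1) → MvPolynomial ℕ ℂ}
    (hP : ∀ Q', ∑ Q, ipTransferMatrixW (n + 1) (genC ℂ q) (genW ℂ) (genZ ℂ) Q Q' * toRF ℂ (P Q) = toRF ℂ (P Q'))
    {P'' : ColPattern n → MvPolynomial ℕ ℂ} (hP''0 : P'' ≠ 0)
    (hP'' : ∀ Q', ∑ Q, ipTransferMatrixW n (genC ℂ q) (genW ℂ) (genZ ℂ) Q Q' * toRF ℂ (P'' Q) = toRF ℂ (P'' Q'))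
    {j : ℕ} (hj : 3 ≤ j) (hsym : rename (Equiv.swap 3 j) (∑ Q, P Q) = ∑ Q, P Q) (k : ColPattern (n + 1)) :
    substHom 1 (C q * X j) (hypSubst q 1 (P k)) = 0 := by
  have h := substHom_wheel_hypSubst_eq_zero hq hP hP''0 hP'' hj hsym k
  have := congrArg (substHom 1 (C q * X j)) h
  rwa [map_zero, ← AlgHom.comp_apply, substHom_one_comp_substHom_wheel hq (show j ≠ 1 by omega)] at this

end DirectRoots

end Literature.Probability.Percolation
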